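import Summits.KontsevichZagierPeriods.KontsevichZagierPeriods.Theorems.RootDecompZetaThreeFrontierThreeLayerP1

/-! # `RootDecompZetaThreeFrontierThreeLayerP2` — part 2/7 of the mechanical ≤340-line split of decomp-kz lens-1 g12 `ThreeLayer_v1.lean`
(sha256 4ebbf5d0…: §18 the diagonal-straightening move Σ / un-bending τ_v and their relations, §47 the layer ⟹ words algorithm;
`…GZLadder.stub_three_layer` of «gz_ladder» v4 on stmt-KontsevichZagierPeriods-32433 is proved in part 7).  Mathematics unchanged; part 2 continues part 1. -/

set_option linter.dupNamespace false

noncomputable section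

namespace Summit.KontsevichZagierPeriods.RootDecompZetaThreeFrontier.WordLayer

open Set MeasureTheory MvPolynomial
open Literature.NumberTheory.Transcendental
open Summit.KontsevichZagierPeriods.KontsevichZagierPeriods.Theses.RootDecompZetaThreeFrontier
open Summit.KontsevichZagierPeriods.KontsevichZagierPeriods.Theorems.RootDecompZetaThreeFrontierWordMoves (mem_simplex_three_iff)

section Straighten

open Literature.ModelTheory.ExponentialFields

/-- Auxiliary step `image_bendΦ`: image bendΦ. [bookkeeping] -/
theorem image_bendΦ : bendΦ '' stDom = stCell := by
  ext t
  constructor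
  · rintro ⟨p, hp, rfl⟩
    exact bendΦ_mem_cell hp
  · intro ht
    exact ⟨bendInv t, bendInv_mem ht, bendΦ_bendInv ht⟩

/-- Auxiliary step `injOn_bendΦ`: inj On bendΦ. [bookkeeping] -/
theorem injOn_bendΦ : InjOn bendΦ stDom := by
  intro p hp q hq h
  have e0 : p 0 = q 0 := by simpa [bendΦ_zero] using congrFun h 0
  have e1 : p 1 = q 1 := by simpa [bendΦ_one] using congrFun h 1
  have hv : (1 : ℝ) - p 1 ≠ 0 := by have := hp.1; have := hp.2.1; linarith
  have e2 : p 2 = q 2 := by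
    have := congrFun h 2
    rw [bendΦ_two, bendΦ_two, ← e1] at this
    exact mul_right_cancel₀ hv (by linarith)
  funext i
  fin_cases i
  · exact e0
  · exact e1
  · exact e2

/-- Auxiliary step `isSemialgebraicMapOn_bendΦ`: is Semialgebraic Map On bendΦ. [bookkeeping] -/
theorem isSemialgebraicMapOn_bendΦ : IsSemialgebraicMapOn ℚ stDom bendΦ :=
  (isSemialgebraicMapOn_aeval isSemialgebraic_stDom
    ![(X 0 : MvPolynomial (Fin 3) ℚ), X 1, X 1 + X 2 * (C 1 - X 1)]).congr
    fun p _ => by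
      funext j
      fin_cases j <;> simp [bendΦ_zero, bendΦ_one, bendΦ_two]

/-- **THE UN-BENDING MOVE, PROVED** (rule (2) with the polynomial chart `τ_v`): a representation `r` on `stDom`
whose integrand is `r'.integrand ∘ τ_v · (1-v)` is congruent to `r'` on `stCell` modulo `KZ.relations`. -/
theorem bend_rel (r r' : KZ.IntegralRep 3) (hr : r.domain = stDom) (hr' : r'.domain = stCell)
    (hi : ∀ p ∈ stDom, r.integrand p = r'.integrand (bendΦ p) * (1 - p 1)) :
    KZ.of r - KZ.of r' ∈ KZ.relations := by
  have hΦsa : IsSemialgebraicMapOn ℚ r.domain bendΦ := by rw [hr]; exact isSemialgebraicMapOn_bendΦ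
  have hder : ∀ x ∈ r.domain, HasFDerivWithinAt bendΦ (bendL x) r.domain x :=
    fun x _ => (hasFDerivAt_bendΦ x).hasFDerivWithinAt
  have hinj : InjOn bendΦ r.domain := by rw [hr]; exact injOn_bendΦ
  have hdom : r'.domain = bendΦ '' r.domain := by rw [hr, image_bendΦ, hr']
  refine KZ.changeOfVariablesRel_subset_relations ⟨3, r, r', bendΦ, bendL, hΦsa, hder, hinj, hdom,
    fun p hp => ?_, rfl⟩
  have hp' : p ∈ stDom := by rw [← hr]; exact hp
  have hv : 0 ≤ 1 - p 1 := by have := hp'.1; have := hp'.2.1; linarith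
  show r.integrand p = r'.integrand (bendΦ p) * |(bendL p).det|
  rw [det_bendL, abs_of_nonneg hv]
  exact hi p hp'

/-- **The two charts composed** (`RUNG3.md` §3 B3): `Σ` then `τ_v` carries `g` on `Δ₃` to `r'` on `stCell` with
integrand `g ∘ Σ⁻¹ ∘ τ_v⁻¹ · (1-s)²/(1-v)` — stated as: if the three integrands are so related, `[g] ≡ [r']`. -/
theorem straighten_bend_rel (g g' r' : KZ.IntegralRep 3) (hg : g.domain = KZ.openOrderedSimplex 3)
    (hg' : g'.domain = stDom) (hr' : r'.domain = stCell)
    (hi₁ : ∀ p ∈ stDom, g'.integrand p = g.integrand (stΨ p) * (1 - p 2) ^ 2)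
    (hi₂ : ∀ p ∈ stDom, g'.integrand p = r'.integrand (bendΦ p) * (1 - p 1)) :
    KZ.of g - KZ.of r' ∈ KZ.relations := by
  have h₁ := straighten_rel g g' hg hg' hi₁
  have h₂ := bend_rel g' r' hg' hr' hi₂
  have : KZ.of g - KZ.of r' = (KZ.of g' - KZ.of r') - (KZ.of g' - KZ.of g) := by abel
  rw [this]
  exact KZ.relations.sub_mem h₂ h₁

/-- Worked instance, both charts: for `G₀ = 1/(t₁(t₀-t₂))` the integrand on `stCell` is `(1-w)/((1-v)² u w)` —
i.e. `(1-s)/(u(v+s(1-v))) = [(1-w)/((1-v)² u w)]·(1-v)` with `w = v + s(1-v)` (`RUNG3.md` §3, first bullet). -/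
theorem straighten_bend_G0 (p : Fin 3 → ℝ) (hp : p ∈ stDom) :
    (1 - p 2) / (p 0 * (p 1 + p 2 * (1 - p 1))) =
      (1 - bendΦ p 2) / ((1 - p 1) ^ 2 * p 0 * bendΦ p 2) * (1 - p 1) := by
  obtain ⟨h10, h0, h1, h2, h21⟩ := hp
  rw [bendΦ_two]
  have hv : (1 : ℝ) - p 1 ≠ 0 := by linarith
  have hu : p 0 ≠ 0 := by linarith
  have hw : p 1 + p 2 * (1 - p 1) ≠ 0 := by nlinarith [mul_pos h2 (show (0:ℝ) < 1 - p 1 by linarith)]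
  field_simp
  ring

/-! ### 18c  CONSTRUCTORS: the straightened / un-bent representations as `IntegralRep`s (integrability transported by
the Jacobian formula, semialgebraicity by Tarski–Seidenberg), so that a prover chains the two charts with NO measure
theory: `straighten_rel'`, `bend_rel'`, `straighten_bend_rel'`. -/

/-- Auxiliary step `measurableSet_stDom`: measurable Set st Dom. [bookkeeping] -/
theorem measurableSet_stDom : MeasurableSet stDom := IsSemialgebraic.measurableSet_holds isSemialgebraic_stDom

/-- Auxiliary step `isSemialgebraic_stCell`: is Semialgebraic st Cell. [bookkeeping] -/
theorem isSemialgebraic_stCell : IsSemialgebraic ℚ stCell := by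
  have e : stCell =
      (((({p : Fin 3 → ℝ | 0 < MvPolynomial.aeval p (X 0 - X 1 : MvPolynomial (Fin 3) ℚ)} ∩
        {p | 0 < MvPolynomial.aeval p (C 1 - X 0 : MvPolynomial (Fin 3) ℚ)}) ∩
        {p | 0 < MvPolynomial.aeval p (X 1 : MvPolynomial (Fin 3) ℚ)}) ∩
        {p | 0 < MvPolynomial.aeval p (X 2 - X 1 : MvPolynomial (Fin 3) ℚ)}) ∩
        {p | 0 < MvPolynomial.aeval p (C 1 - X 2 : MvPolynomial (Fin 3) ℚ)}) := by
    ext p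
    simp only [mem_stCell_iff, Set.mem_inter_iff, Set.mem_setOf_eq, map_sub, MvPolynomial.aeval_X,
      map_one, sub_pos]
    tauto
  rw [e]
  exact ((((isSemialgebraic_pos3 _).inter (isSemialgebraic_pos3 _)).inter (isSemialgebraic_pos3 _)).inter
    (isSemialgebraic_pos3 _)).inter (isSemialgebraic_pos3 _)

/-- Auxiliary step `measurableSet_stCell`: measurable Set st Cell. [bookkeeping] -/
theorem measurableSet_stCell : MeasurableSet stCell :=
  IsSemialgebraic.measurableSet_holds isSemialgebraic_stCell

/-- Auxiliary step `mapsTo_stΨ`: maps To stΨ. [bookkeeping] -/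
theorem mapsTo_stΨ : MapsTo stΨ stDom (KZ.openOrderedSimplex 3) := fun _ hp => stΨ_mem_simplex hp

/-- Auxiliary step `mapsTo_bendInv`: maps To bend Inv. [bookkeeping] -/
theorem mapsTo_bendInv : MapsTo bendInv stCell stDom := fun _ ht => bendInv_mem ht

/-- Auxiliary step `bendInv_bendΦ`: bend Inv bendΦ. [bookkeeping] -/
theorem bendInv_bendΦ {p : Fin 3 → ℝ} (hp : p ∈ stDom) : bendInv (bendΦ p) = p := by
  obtain ⟨h10, h0, h1, h2, h21⟩ := hp
  have hv : (1 : ℝ) - p 1 ≠ 0 := by linarith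
  funext i
  fin_cases i
  · simp [bendΦ, bendInv]
  · simp [bendΦ, bendInv]
  · simp [bendΦ, bendInv]; field_simp

/-- Auxiliary step `isSemialgebraicMapOn_bendInv`: is Semialgebraic Map On bend Inv. [bookkeeping] -/
theorem isSemialgebraicMapOn_bendInv : IsSemialgebraicMapOn ℚ stCell bendInv := by
  refine IsSemialgebraicMapOn.of_forall isSemialgebraic_stCell fun j => ?_
  fin_cases j
  · exact (isSemialgebraicFunOn_aeval isSemialgebraic_stCell (X 0 : MvPolynomial (Fin 3) ℚ)).congr
      fun t _ => by simp [bendInv]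
  · exact (isSemialgebraicFunOn_aeval isSemialgebraic_stCell (X 1 : MvPolynomial (Fin 3) ℚ)).congr
      fun t _ => by simp [bendInv]
  · refine (isSemialgebraicFunOn_aeval_div_aeval isSemialgebraic_stCell (X 2 - X 1 : MvPolynomial (Fin 3) ℚ)
      (C 1 - X 1) fun t ht => ?_).congr fun t ht => ?_
    · obtain ⟨h10, h0, h1, h12, h2⟩ := ht
      have : (1 : ℝ) - t 1 ≠ 0 := by linarith
      simpa using this
    · simp [bendInv]

/-- `Σ_* g`: the straightened representation of `g` (domain `stDom`, integrand `g ∘ Σ⁻¹ · (1-s)²`). -/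
noncomputable def straightenRep (g : KZ.IntegralRep 3) (hg : g.domain = KZ.openOrderedSimplex 3) :
    KZ.IntegralRep 3 where
  domain := stDom
  integrand := fun p => g.integrand (stΨ p) * (1 - p 2) ^ 2
  isSemialgebraic_domain := isSemialgebraic_stDom
  isSemialgebraicFunOn_integrand := by
    have hgs : IsSemialgebraicFunOn ℚ (KZ.openOrderedSimplex 3) g.integrand := hg ▸ g.isSemialgebraicFunOn_integrand
    have h1 : IsSemialgebraicFunOn ℚ stDom (g.integrand ∘ stΨ) :=
      IsSemialgebraicFunOn.comp_isSemialgebraicMapOn_holds hgs isSemialgebraicMapOn_stΨ mapsTo_stΨ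
    have h2 : IsSemialgebraicFunOn ℚ stDom (fun p : Fin 3 → ℝ => (1 - p 2) ^ 2) :=
      (isSemialgebraicFunOn_aeval isSemialgebraic_stDom ((C 1 - X 2) ^ 2 : MvPolynomial (Fin 3) ℚ)).congr
        fun p _ => by simp
    exact IsSemialgebraicFunOn.mul_holds h1 h2
  integrableOn := by
    have key := (integrableOn_image_iff_integrableOn_abs_det_fderiv_smul (μ := volume) measurableSet_stDom
      (fun x _ => (hasFDerivAt_stΨ x).hasFDerivWithinAt) injOn_stΨ g.integrand).1
      (by rw [image_stΨ, ← hg]; exact g.integrableOn)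
    refine key.congr_fun (fun p _ => ?_) measurableSet_stDom
    simp only [abs_det_stL, smul_eq_mul]
    ring

/-- Auxiliary step `straightenRep_domain`: straighten Rep domain. [bookkeeping] -/
theorem straightenRep_domain (g : KZ.IntegralRep 3) (hg : g.domain = KZ.openOrderedSimplex 3) :
    (straightenRep g hg).domain = stDom := rfl

/-- Auxiliary step `straightenRep_integrand`: straighten Rep integrand. [bookkeeping] -/
theorem straightenRep_integrand (g : KZ.IntegralRep 3) (hg : g.domain = KZ.openOrderedSimplex 3)
    (p : Fin 3 → ℝ) : (straightenRep g hg).integrand p = g.integrand (stΨ p) * (1 - p 2) ^ 2 := rfl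

/-- **Σ as a move, constructor form**: `[Σ_* g] ≡ [g]`. -/
theorem straighten_rel' (g : KZ.IntegralRep 3) (hg : g.domain = KZ.openOrderedSimplex 3) :
    KZ.of (straightenRep g hg) - KZ.of g ∈ KZ.relations :=
  straighten_rel g (straightenRep g hg) hg rfl fun _ _ => rfl

/-- `(τ_v)_* r`: the un-bent representation of `r` (domain `stCell`, integrand `r ∘ τ_v⁻¹ / (1-v)`). -/
noncomputable def bendRep (r : KZ.IntegralRep 3) (hr : r.domain = stDom) : KZ.IntegralRep 3 where
  domain := stCell
  integrand := fun t => r.integrand (bendInv t) * (1 / (1 - t 1))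
  isSemialgebraic_domain := isSemialgebraic_stCell
  isSemialgebraicFunOn_integrand := by
    have hrs : IsSemialgebraicFunOn ℚ stDom r.integrand := hr ▸ r.isSemialgebraicFunOn_integrand
    have h1 : IsSemialgebraicFunOn ℚ stCell (r.integrand ∘ bendInv) :=
      IsSemialgebraicFunOn.comp_isSemialgebraicMapOn_holds hrs isSemialgebraicMapOn_bendInv mapsTo_bendInv
    have h2 : IsSemialgebraicFunOn ℚ stCell (fun t : Fin 3 → ℝ => 1 / (1 - t 1)) := by
      refine (isSemialgebraicFunOn_aeval_div_aeval isSemialgebraic_stCell (C 1 : MvPolynomial (Fin 3) ℚ)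
        (C 1 - X 1) fun t ht => ?_).congr fun t ht => ?_
      · obtain ⟨h10, h0, h1, h12, h2⟩ := ht
        have : (1 : ℝ) - t 1 ≠ 0 := by linarith
        simpa using this
      · simp
    exact IsSemialgebraicFunOn.mul_holds h1 h2
  integrableOn := by
    have hrint : IntegrableOn r.integrand stDom := hr ▸ r.integrableOn
    have key := (integrableOn_image_iff_integrableOn_abs_det_fderiv_smul (μ := volume) measurableSet_stDom
      (fun x _ => (hasFDerivAt_bendΦ x).hasFDerivWithinAt) injOn_bendΦ
      (fun t => r.integrand (bendInv t) * (1 / (1 - t 1)))).2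
      (hrint.congr_fun (fun p hp => ?_) measurableSet_stDom)
    · rwa [image_bendΦ] at key
    · have hv : (1 : ℝ) - p 1 ≠ 0 := by have := hp.1; have := hp.2.1; linarith
      have hv' : 0 ≤ 1 - p 1 := by have := hp.1; have := hp.2.1; linarith
      simp only [det_bendL, abs_of_nonneg hv', smul_eq_mul, bendInv_bendΦ hp, bendΦ_one]
      field_simp

/-- Auxiliary step `bendRep_domain`: bend Rep domain. [bookkeeping] -/
theorem bendRep_domain (r : KZ.IntegralRep 3) (hr : r.domain = stDom) : (bendRep r hr).domain = stCell := rfl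

/-- Auxiliary step `bendRep_integrand`: bend Rep integrand. [bookkeeping] -/
theorem bendRep_integrand (r : KZ.IntegralRep 3) (hr : r.domain = stDom) (t : Fin 3 → ℝ) :
    (bendRep r hr).integrand t = r.integrand (bendInv t) * (1 / (1 - t 1)) := rfl

/-- **τ_v as a move, constructor form**: `[r] ≡ [(τ_v)_* r]`. -/
theorem bend_rel' (r : KZ.IntegralRep 3) (hr : r.domain = stDom) :
    KZ.of r - KZ.of (bendRep r hr) ∈ KZ.relations := by
  refine bend_rel r (bendRep r hr) hr rfl fun p hp => ?_
  have hv : (1 : ℝ) - p 1 ≠ 0 := by have := hp.1; have := hp.2.1; linarith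
  rw [bendRep_integrand, bendInv_bendΦ hp, bendΦ_one]
  field_simp

/-- **B3 in constructor form**: `[g] ≡ [(τ_v)_* Σ_* g]` for every `g` on `Δ₃` — two rule-(2) moves, no side
conditions left to the user. -/
theorem straighten_bend_rel' (g : KZ.IntegralRep 3) (hg : g.domain = KZ.openOrderedSimplex 3) :
    KZ.of g - KZ.of (bendRep (straightenRep g hg) rfl) ∈ KZ.relations := by
  have h₁ := straighten_rel' g hg
  have h₂ := bend_rel' (straightenRep g hg) rfl
  have : KZ.of g - KZ.of (bendRep (straightenRep g hg) rfl) =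
      (KZ.of (straightenRep g hg) - KZ.of (bendRep (straightenRep g hg) rfl)) -
        (KZ.of (straightenRep g hg) - KZ.of g) := by abel
  rw [this]
  exact KZ.relations.sub_mem h₂ h₁

/-- The composite integrand in closed form: on `stCell`, `((τ_v)_* Σ_* g)(u,v,w) = g(Σ⁻¹(u,v,s)) · (1-s)²/(1-v)` with
`s = (w-v)/(1-v)`. -/
theorem bend_straighten_integrand (g : KZ.IntegralRep 3) (hg : g.domain = KZ.openOrderedSimplex 3)
    (t : Fin 3 → ℝ) :
    (bendRep (straightenRep g hg) rfl).integrand t =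
      g.integrand (stΨ (bendInv t)) * (1 - (t 2 - t 1) / (1 - t 1)) ^ 2 * (1 / (1 - t 1)) := by
  rw [bendRep_integrand, straightenRep_integrand]
  simp [bendInv]

/-! ### 18d  The rule-(1a) split of the un-bent cell along `u = w` and the coordinate swap onto `Δ₃`:
`stCell = cellA ⊔ cellB`, `cellA = {1 > u > w > v > 0}` (the swap `(u,v,w) ↦ (u,w,v)` of `Δ₃`),
`cellB = {1 > w ≥ u > v > 0}` (`Δ₃` in the order `(w,u,v)` up to the null plane `u = w`).  With 18c this completes
B3 of `RUNG3.md` §3 as kernel theorems: every class on `Δ₃` is congruent to a sum of two classes whose every factor,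
for a straightened reduced genus-zero datum, is a coordinate or `1 -` a coordinate. -/

/-- Restriction of a representation to a semialgebraic subset of its domain. -/
noncomputable def restrictRep {n : ℕ} (r : KZ.IntegralRep n) (S : Set (Fin n → ℝ)) (hS : IsSemialgebraic ℚ S)
    (hsub : S ⊆ r.domain) : KZ.IntegralRep n where
  domain := S
  integrand := r.integrand
  isSemialgebraic_domain := hS
  isSemialgebraicFunOn_integrand := r.isSemialgebraicFunOn_integrand.mono hsub hS
  integrableOn := r.integrableOn.mono_set hsub

/-- Auxiliary step `restrictRep_domain`: restrict Rep domain. [bookkeeping] -/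
theorem restrictRep_domain {n : ℕ} (r : KZ.IntegralRep n) (S : Set (Fin n → ℝ)) (hS : IsSemialgebraic ℚ S)
    (hsub : S ⊆ r.domain) : (restrictRep r S hS hsub).domain = S := rfl

/-- Auxiliary step `restrictRep_integrand`: restrict Rep integrand. [bookkeeping] -/
theorem restrictRep_integrand {n : ℕ} (r : KZ.IntegralRep n) (S : Set (Fin n → ℝ)) (hS : IsSemialgebraic ℚ S)
    (hsub : S ⊆ r.domain) : (restrictRep r S hS hsub).integrand = r.integrand := rfl

/-- **Rule (1a), disjoint form**: splitting the domain into two DISJOINT semialgebraic pieces is a relation. -/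
theorem split_rel {n : ℕ} (r : KZ.IntegralRep n) (A B : Set (Fin n → ℝ)) (hA : IsSemialgebraic ℚ A)
    (hB : IsSemialgebraic ℚ B) (hAB : Disjoint A B) (hr : r.domain = A ∪ B) :
    KZ.of r - KZ.of (restrictRep r A hA (hr ▸ Set.subset_union_left)) -
      KZ.of (restrictRep r B hB (hr ▸ Set.subset_union_right)) ∈ KZ.relations := by
  refine KZ.domainAddRel_subset_relations ⟨n, r, restrictRep r A hA (hr ▸ Set.subset_union_left),
    restrictRep r B hB (hr ▸ Set.subset_union_right), hr, ?_, fun _ _ => rfl, fun _ _ => rfl, rfl⟩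
  show volume (A ∩ B) = 0
  rw [Set.disjoint_iff_inter_eq_empty.1 hAB, measure_empty]

/-- the lower piece `{1 > u > w > v > 0}` of the un-bent cell -/
def cellA : Set (Fin 3 → ℝ) := {p | p ∈ stCell ∧ p 2 < p 0}
/-- the upper piece `{1 > w ≥ u > v > 0}` of the un-bent cell -/
def cellB : Set (Fin 3 → ℝ) := {p | p ∈ stCell ∧ p 0 ≤ p 2}

/-- Auxiliary step `isSemialgebraic_cellA`: is Semialgebraic cell A. [bookkeeping] -/
theorem isSemialgebraic_cellA : IsSemialgebraic ℚ cellA := by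
  have e : cellA = stCell ∩ {p : Fin 3 → ℝ | 0 < MvPolynomial.aeval p (X 0 - X 2 : MvPolynomial (Fin 3) ℚ)} := by
    ext p
    simp only [cellA, Set.mem_inter_iff, Set.mem_setOf_eq, map_sub, MvPolynomial.aeval_X, sub_pos]
  rw [e]
  exact isSemialgebraic_stCell.inter (isSemialgebraic_pos3 _)

/-- Auxiliary step `isSemialgebraic_cellB`: is Semialgebraic cell B. [bookkeeping] -/
theorem isSemialgebraic_cellB : IsSemialgebraic ℚ cellB := by
  have e : cellB = stCell ∩ {p : Fin 3 → ℝ | 0 < MvPolynomial.aeval p (X 0 - X 2 : MvPolynomial (Fin 3) ℚ)}ᶜ := by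
    ext p
    simp only [cellB, Set.mem_inter_iff, Set.mem_setOf_eq, Set.mem_compl_iff, map_sub, MvPolynomial.aeval_X,
      sub_pos, not_lt]
  rw [e]
  exact isSemialgebraic_stCell.inter (isSemialgebraic_pos3 _).compl

/-- Auxiliary step `disjoint_cellA_cellB`: disjoint cell A cell B. [bookkeeping] -/
theorem disjoint_cellA_cellB : Disjoint cellA cellB := by
  rw [Set.disjoint_left]
  rintro p ⟨-, hA⟩ ⟨-, hB⟩
  exact absurd hA (not_lt.2 hB)

/-- Auxiliary step `stCell_eq_union`: st Cell eq union. [bookkeeping] -/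
theorem stCell_eq_union : stCell = cellA ∪ cellB := by
  ext p
  simp only [cellA, cellB, Set.mem_union, Set.mem_setOf_eq]
  constructor
  · intro hp
    rcases lt_or_ge (p 2) (p 0) with h | h
    · exact Or.inl ⟨hp, h⟩
    · exact Or.inr ⟨hp, h⟩
  · rintro (⟨hp, -⟩ | ⟨hp, -⟩) <;> exact hp

/-- **The u = w split as a move**: a representation on the un-bent cell is congruent to the sum of its restrictions
to `cellA` and `cellB`. -/
theorem cell_split_rel (r : KZ.IntegralRep 3) (hr : r.domain = stCell) :
    KZ.of r - KZ.of (restrictRep r cellA isSemialgebraic_cellA (by rw [hr, stCell_eq_union]; exact Set.subset_union_left)) -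
      KZ.of (restrictRep r cellB isSemialgebraic_cellB (by rw [hr, stCell_eq_union]; exact Set.subset_union_right)) ∈
      KZ.relations :=
  split_rel r cellA cellB isSemialgebraic_cellA isSemialgebraic_cellB disjoint_cellA_cellB (hr.trans stCell_eq_union)

end Straighten

end Summit.KontsevichZagierPeriods.RootDecompZetaThreeFrontier.WordLayer
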